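import Literature.NumberTheory.EllipticCurves.IwasawaSelmerSupersingularLocalProofs
import Literature.NumberTheory.EllipticCurves.Sprung2012.ColemanMaps
import Literature.NumberTheory.GaloisRepresentations.ContinuousH1
import Summits.BirchSwinnertonDyer.BirchSwinnertonDyer.Theorems.ByReductionTypeAtTwoSupersingularFlatKummerIndependence
import HarnessLib

/-!
# Route `ByReductionTypeAtTwo` (rung K4), crux `SupersingularRankZeroAtTwo` (item stmt-BirchSwinnertonDyer-19097), stub 5
# `stub_flatKernelCyclic` ⟸ K86 `H1IwPointsModelFreeAtTwo` (hand hK86-G): **THE LOCAL KUMMER MAP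
# `E(K_∞·K_v) ⊗ ℚ_p/ℤ_p → H¹(K_∞·K_v, E[p^∞])` ON COCYCLES** — existence, additivity, `p •`, kernel, conjugation
# (cell `bsd-2adic`, seat `bsd-2adic-tower-1` GEN 65; `--supports 19097`, helper; generic `K`, `p`, `κ`, `E`)

HONEST FRAMING (D-0036/D-0054): THEOREMS ONLY (no definition, no named fact, no `sorry`, no instance). Link (3)/(4)
of the PRINT ∘ KERNEL road to K86 (`Cruxes/SupersingularRankZeroAtTwo/D86H1IwFreeAtTwo.lean`), LOCAL side: the
five properties of an abstract Kummer structure (file `…KummerStructureBiduality`,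
`LocalIwH1.exists_toDual_bijective_of_kummerStructure`) except ONTO (file `…LocalKummerOnto`, Coates–Greenberg),
for the genuine local Kummer map of an elliptic curve.

SETTING. `K` a field, `W/K` elliptic, `p` prime, `κ : ZpExtension K p`, `E` a `K`-field (a completion `K_v`),
`Γ_E = absoluteGaloisGroup E`, `G = localSubgroup κ.kerSubgroup E = Gal(K̄_E / K_∞·E)` (chosen embedding `closureEmb`),
`M = E(K̄_E)[p^∞] = AddCommGroup.primaryComponent (localPoints W E) p`, `N = E(K_∞·E) = localTowerPointsOfEmb κ
(closureEmb E) W = E(K̄_E)^G` (Sprung's tower points), `H = H¹(G, M) = discreteH1 G M` (continuous cohomology of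
the discrete module). The KUMMER COCYCLE of `a ∈ E(K̄_E)` with `p^k a = x ∈ N` is `τ ↦ τa − a` (`G → E[p^k] ⊆ M`,
continuous); its class `κ(x ⊗ p^{-k}) ∈ H` depends only on `(x, k)`.

* §1 `exists_kummerCocycle` — the Kummer cocycle exists as a `contOneCocycles`; `oneCocycleClass_eq_of_kummer` — two
  Kummer cocycles of the same `(x, k)` have the same class (they differ by the coboundary of a `p^k`-torsion point).
* §2 `exists_localKummerMap` — a map `κf : N → ℕ → H` with `[τ ↦ τa − a] = κf x k` whenever `p^k a = x`
  (CHARACTERISATION; every later statement takes this characterisation as its hypothesis `hκ`).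
* §3 the structure: `localKummerMap_add` (`κf (x+y) k = κf x k + κf y k`), `localKummerMap_zero` (`κf x 0 = 0`),
  `localKummerMap_succ` (`p • κf x (k+1) = κf x k`), `localKummerMap_ker` (`κf x k = 0 ⇒ p^k ∣ z x` for every
  `z : N →+ ℤ_p`: the class dies iff `a ≡ t (mod N)` for a torsion `t`, and `ℤ_p`-functionals kill torsion),
  `localKummerMap_conj` (`conj_σ (κf x k) = κf (σx) k` for EVERY `σ ∈ Γ_E`: `(conj_σ φ)(h) = σ φ(σ⁻¹hσ) = hσa − σa`).
19097 OPEN; nothing booked; BSD proved for no curve; typed ≠ proved.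

References: [GreenbergLNM1716] §2 pp. 82–83 (the Kummer sequence over `K_∞K_v`); [Kobayashi2003] §2 p. 4;
[SilvermanAEC2009] VIII.§2; [NeukirchSchmidtWingberg2008] I §5 (conjugation on cochains).
-/

set_option autoImplicit false
-- the Theorems namespace of this sub repeats the summit name by design (D-0017 nested layout)
set_option linter.dupNamespace false

noncomputable section

open scoped Classical

universe u

namespace Summit.BirchSwinnertonDyer.BirchSwinnertonDyer.Theorems

namespace LocalIwH1

open Field WeierstrassCurve Literature.NumberTheory.EllipticCurves Literature.NumberTheory.EllipticCurves.Sprung2012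
  Literature.NumberTheory.GaloisRepresentations ZpExtension

variable {K : Type u} [Field K] {p : ℕ} [hp : Fact p.Prime] (κ : ZpExtension K p)
variable (E : Type u) [Field E] [Algebra K E] (W : WeierstrassCurve K)

/-! ### §1 The Kummer cocycle `τ ↦ τa − a` -/

/-- The values `τa − a`, `τ ∈ Gal(K̄_E/K_∞·E)`, of a point `a` with `p^k a ∈ E(K_∞·E)` are `p^k`-torsion.
[cite: GreenbergLNM1716, §2 (pp. 82–83)] -/
theorem pow_nsmul_sub_eq_zero_of_mem {a : localPoints W E} {k : ℕ}
    (ha : p ^ k • a ∈ localTowerPointsOfEmb κ (closureEmb (K := K) E) W)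
    (τ : localSubgroup κ.kerSubgroup E) : p ^ k • ((τ : absoluteGaloisGroup E) • a - a) = 0 := by
  have h := (mem_localTowerPointsOfEmb_iff κ (closureEmb (K := K) E) W _).mp ha τ τ.2
  rw [smul_sub, smul_comm, h, sub_self]

/-- **The Kummer cocycle.** For `a ∈ E(K̄_E)` with `p^k a ∈ E(K_∞·E)`, `τ ↦ τa − a` is a continuous crossed
homomorphism `Gal(K̄_E/K_∞·E) → E(K̄_E)[p^∞]`. [cite: GreenbergLNM1716, §2 (pp. 82–83)] [cite: SilvermanAEC2009, VIII.§2] -/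
theorem exists_kummerCocycle (a : localPoints W E) {k : ℕ}
    (ha : p ^ k • a ∈ localTowerPointsOfEmb κ (closureEmb (K := K) E) W) :
    ∃ φ : contOneCocycles (discreteTopRep (localSubgroup κ.kerSubgroup E)
        (AddCommGroup.primaryComponent (localPoints W E) p)),
      ∀ τ : localSubgroup κ.kerSubgroup E,
        ((φ.1 τ : AddCommGroup.primaryComponent (localPoints W E) p) : localPoints W E) =
          (τ : absoluteGaloisGroup E) • a - a := by
  set f : localSubgroup κ.kerSubgroup E → AddCommGroup.primaryComponent (localPoints W E) p :=
    fun τ ↦ ⟨(τ : absoluteGaloisGroup E) • a - a, ⟨k, pow_nsmul_sub_eq_zero_of_mem κ E W ha τ⟩⟩ with hf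
  have hfc : Continuous f := by
    refine Continuous.subtype_mk ?_ _
    have hc : Continuous ((fun σ : absoluteGaloisGroup E ↦ σ • a) ∘
        (Subtype.val : ↥(localSubgroup κ.kerSubgroup E) → absoluteGaloisGroup E)) :=
      (continuous_smul_localPoints W E a).comp continuous_subtype_val
    exact hc.sub continuous_const
  refine ⟨⟨⟨f, hfc⟩, fun g h ↦ Subtype.ext ?_⟩, fun τ ↦ rfl⟩
  change ((g * h : localSubgroup κ.kerSubgroup E) : absoluteGaloisGroup E) • a - a =
    ((g : absoluteGaloisGroup E) • a - a) + (g : absoluteGaloisGroup E) • ((h : absoluteGaloisGroup E) • a - a)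
  rw [Subgroup.coe_mul, mul_smul, smul_sub]
  abel

/-- **The class of a Kummer cocycle depends only on `(x, k)`**: two cocycles with values `τa − a`, `τa' − a'` for
`p^k a = p^k a' = x` have the same class (`a − a' ∈ E[p^k]`, so they differ by a coboundary with values in `M`).
[cite: GreenbergLNM1716, §2 (pp. 82–83)] [cite: Kobayashi2003, §2 p. 4] -/
theorem oneCocycleClass_eq_of_kummer {a a' : localPoints W E} {k : ℕ} (haa' : p ^ k • a = p ^ k • a')
    {φ φ' : contOneCocycles (discreteTopRep (localSubgroup κ.kerSubgroup E)
      (AddCommGroup.primaryComponent (localPoints W E) p))}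
    (hφ : ∀ τ : localSubgroup κ.kerSubgroup E,
      ((φ.1 τ : AddCommGroup.primaryComponent (localPoints W E) p) : localPoints W E) =
        (τ : absoluteGaloisGroup E) • a - a)
    (hφ' : ∀ τ : localSubgroup κ.kerSubgroup E,
      ((φ'.1 τ : AddCommGroup.primaryComponent (localPoints W E) p) : localPoints W E) =
        (τ : absoluteGaloisGroup E) • a' - a') :
    oneCocycleClass _ φ = oneCocycleClass _ φ' := by
  rw [← sub_eq_zero, ← oneCocycleClass_sub, oneCocycleClass_eq_zero_iff]
  refine ⟨⟨a - a', ⟨k, by rw [smul_sub, haa', sub_self]⟩⟩, fun τ ↦ Subtype.ext ?_⟩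
  change (((φ - φ').1 τ : AddCommGroup.primaryComponent (localPoints W E) p) : localPoints W E) =
    (τ : absoluteGaloisGroup E) • (a - a') - (a - a')
  rw [Literature.NumberTheory.EllipticCurves.cocycle_sub_apply, AddSubgroupClass.coe_sub, hφ, hφ', smul_sub]
  abel

/-! ### §2 The local Kummer map `(x, k) ↦ κ(x ⊗ p^{-k})` -/

/-- **The local Kummer map exists**: a function `κf : E(K_∞·E) → ℕ → H¹(K_∞·E, E[p^∞])` such that
`κf x k` is the class of `τ ↦ τa − a` for EVERY `a` with `p^k a = x` and every cocycle with these values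
(`E(K̄_E)` is divisible: `nsmul_surjective_localPoints`). [cite: GreenbergLNM1716, §2 (pp. 82–83)] [cite: SilvermanAEC2009, VIII.§2] -/
theorem exists_localKummerMap [W.IsElliptic] :
    ∃ κf : localTowerPointsOfEmb κ (closureEmb (K := K) E) W → ℕ →
        discreteH1 (localSubgroup κ.kerSubgroup E) (AddCommGroup.primaryComponent (localPoints W E) p),
      ∀ (x : localTowerPointsOfEmb κ (closureEmb (K := K) E) W) (k : ℕ) (a : localPoints W E),
        p ^ k • a = (x : localPoints W E) →
        ∀ φ : contOneCocycles (discreteTopRep (localSubgroup κ.kerSubgroup E)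
            (AddCommGroup.primaryComponent (localPoints W E) p)),
          (∀ τ : localSubgroup κ.kerSubgroup E,
            ((φ.1 τ : AddCommGroup.primaryComponent (localPoints W E) p) : localPoints W E) =
              (τ : absoluteGaloisGroup E) • a - a) →
          oneCocycleClass _ φ = κf x k := by
  -- a `p^k`-th root of every tower point, and its Kummer cocycle
  have hroot : ∀ (x : localTowerPointsOfEmb κ (closureEmb (K := K) E) W) (k : ℕ),
      ∃ a : localPoints W E, p ^ k • a = (x : localPoints W E) := fun x k ↦
    W.nsmul_surjective_localPoints E (pow_ne_zero k hp.out.ne_zero) (x : localPoints W E)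
  choose root hroot using hroot
  have hcoc : ∀ (x : localTowerPointsOfEmb κ (closureEmb (K := K) E) W) (k : ℕ),
      ∃ φ : contOneCocycles (discreteTopRep (localSubgroup κ.kerSubgroup E)
          (AddCommGroup.primaryComponent (localPoints W E) p)),
        ∀ τ : localSubgroup κ.kerSubgroup E,
          ((φ.1 τ : AddCommGroup.primaryComponent (localPoints W E) p) : localPoints W E) =
            (τ : absoluteGaloisGroup E) • root x k - root x k := fun x k ↦
    exists_kummerCocycle κ E W (root x k) (by rw [hroot]; exact x.2)
  choose coc hcoc using hcoc
  refine ⟨fun x k ↦ oneCocycleClass _ (coc x k), fun x k a ha φ hφ ↦ ?_⟩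
  exact oneCocycleClass_eq_of_kummer κ E W (by rw [ha, hroot]) hφ (hcoc x k)

/-! ### §3 Additivity, `p •`, kernel and conjugation of the local Kummer map -/

section Structure

variable {κ E W}
variable {κf : localTowerPointsOfEmb κ (closureEmb (K := K) E) W → ℕ →
  discreteH1 (localSubgroup κ.kerSubgroup E) (AddCommGroup.primaryComponent (localPoints W E) p)}

/-- **Additivity**: `κf (x + y) k = κf x k + κf y k` (roots add, Kummer cocycles add).
[cite: GreenbergLNM1716, §2 (pp. 82–83)] [cite: Kobayashi2003, §2 p. 4] -/
theorem localKummerMap_add [W.IsElliptic]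
    (hκ : ∀ (x : localTowerPointsOfEmb κ (closureEmb (K := K) E) W) (k : ℕ) (a : localPoints W E),
      p ^ k • a = (x : localPoints W E) →
      ∀ φ : contOneCocycles (discreteTopRep (localSubgroup κ.kerSubgroup E)
          (AddCommGroup.primaryComponent (localPoints W E) p)),
        (∀ τ : localSubgroup κ.kerSubgroup E,
          ((φ.1 τ : AddCommGroup.primaryComponent (localPoints W E) p) : localPoints W E) =
            (τ : absoluteGaloisGroup E) • a - a) →
        oneCocycleClass _ φ = κf x k)
    (x y : localTowerPointsOfEmb κ (closureEmb (K := K) E) W) (k : ℕ) : κf (x + y) k = κf x k + κf y k := by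
  obtain ⟨a, ha⟩ := W.nsmul_surjective_localPoints E (pow_ne_zero k hp.out.ne_zero) (x : localPoints W E)
  obtain ⟨b, hb⟩ := W.nsmul_surjective_localPoints E (pow_ne_zero k hp.out.ne_zero) (y : localPoints W E)
  change p ^ k • a = (x : localPoints W E) at ha
  change p ^ k • b = (y : localPoints W E) at hb
  obtain ⟨φ, hφ⟩ := exists_kummerCocycle κ E W a (k := k) (by rw [ha]; exact x.2)
  obtain ⟨ψ, hψ⟩ := exists_kummerCocycle κ E W b (k := k) (by rw [hb]; exact y.2)
  rw [← hκ x k a ha φ hφ, ← hκ y k b hb ψ hψ, ← oneCocycleClass_add]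
  refine (hκ (x + y) k (a + b) (by rw [smul_add, ha, hb, AddSubgroup.coe_add]) (φ + ψ) fun τ ↦ ?_).symm
  rw [Submodule.coe_add, ContinuousMap.add_apply, AddSubgroup.coe_add, hφ, hψ, smul_add]
  abel

/-- **Level zero**: `κf x 0 = 0` (`a = x` is fixed by `G`, the cocycle vanishes). [cite: GreenbergLNM1716, §2 (pp. 82–83)] -/
theorem localKummerMap_zero
    (hκ : ∀ (x : localTowerPointsOfEmb κ (closureEmb (K := K) E) W) (k : ℕ) (a : localPoints W E),
      p ^ k • a = (x : localPoints W E) →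
      ∀ φ : contOneCocycles (discreteTopRep (localSubgroup κ.kerSubgroup E)
          (AddCommGroup.primaryComponent (localPoints W E) p)),
        (∀ τ : localSubgroup κ.kerSubgroup E,
          ((φ.1 τ : AddCommGroup.primaryComponent (localPoints W E) p) : localPoints W E) =
            (τ : absoluteGaloisGroup E) • a - a) →
        oneCocycleClass _ φ = κf x k)
    (x : localTowerPointsOfEmb κ (closureEmb (K := K) E) W) : κf x 0 = 0 := by
  have hfix : ∀ τ : localSubgroup κ.kerSubgroup E, (τ : absoluteGaloisGroup E) • (x : localPoints W E) = x :=
    fun τ ↦ (mem_localTowerPointsOfEmb_iff κ (closureEmb (K := K) E) W _).mp x.2 τ τ.2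
  rw [← hκ x 0 (x : localPoints W E) (by rw [pow_zero, one_smul]) 0 fun τ ↦ by
    rw [hfix, sub_self]; rfl]
  exact oneCocycleClass_zero _

/-- **`p • κf x (k+1) = κf x k`**: if `p^{k+1} a = x` then `p a` is a `p^k`-th root of `x`, and `p • (τa − a) =
τ(pa) − pa`. [cite: GreenbergLNM1716, §2 (pp. 82–83)] [cite: Kobayashi2003, §2 p. 4] -/
theorem localKummerMap_succ [W.IsElliptic]
    (hκ : ∀ (x : localTowerPointsOfEmb κ (closureEmb (K := K) E) W) (k : ℕ) (a : localPoints W E),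
      p ^ k • a = (x : localPoints W E) →
      ∀ φ : contOneCocycles (discreteTopRep (localSubgroup κ.kerSubgroup E)
          (AddCommGroup.primaryComponent (localPoints W E) p)),
        (∀ τ : localSubgroup κ.kerSubgroup E,
          ((φ.1 τ : AddCommGroup.primaryComponent (localPoints W E) p) : localPoints W E) =
            (τ : absoluteGaloisGroup E) • a - a) →
        oneCocycleClass _ φ = κf x k)
    (x : localTowerPointsOfEmb κ (closureEmb (K := K) E) W) (k : ℕ) : p • κf x (k + 1) = κf x k := by
  obtain ⟨a, ha⟩ := W.nsmul_surjective_localPoints E (pow_ne_zero (k + 1) hp.out.ne_zero) (x : localPoints W E)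
  change p ^ (k + 1) • a = (x : localPoints W E) at ha
  obtain ⟨φ, hφ⟩ := exists_kummerCocycle κ E W a (k := k + 1) (by rw [ha]; exact x.2)
  rw [← hκ x (k + 1) a ha φ hφ]
  have hns : p • oneCocycleClass _ φ = oneCocycleClass _ (p • φ) := by
    have h := oneCocycleClass_smul (discreteTopRep (localSubgroup κ.kerSubgroup E)
      (AddCommGroup.primaryComponent (localPoints W E) p)) ((p : ℕ) : ℤ) φ
    simp only [Nat.cast_smul_eq_nsmul] at h
    exact h.symm
  rw [hns]
  refine hκ x k (p • a) (by rw [smul_smul, ← pow_succ, ha]) (p • φ) fun τ ↦ ?_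
  rw [Literature.NumberTheory.EllipticCurves.cocycle_nsmul_apply, AddSubgroupClass.coe_nsmul, hφ, smul_sub,
    smul_comm]

/-- **Kernel**: if `κf x k = 0` then every `z : E(K_∞·E) →+ ℤ_p` has `p^k ∣ z x`. Indeed `τa − a = τt − t` for a
torsion point `t`, so `a − t ∈ E(K_∞·E)` and `x = p^k (a − t) + p^k t` with `p^k t ∈ E(K_∞·E)` torsion, killed by `z`.
[cite: GreenbergLNM1716, §2 (pp. 82–83)] [cite: Kobayashi2003, §2 p. 4] -/
theorem localKummerMap_ker [W.IsElliptic]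
    (hκ : ∀ (x : localTowerPointsOfEmb κ (closureEmb (K := K) E) W) (k : ℕ) (a : localPoints W E),
      p ^ k • a = (x : localPoints W E) →
      ∀ φ : contOneCocycles (discreteTopRep (localSubgroup κ.kerSubgroup E)
          (AddCommGroup.primaryComponent (localPoints W E) p)),
        (∀ τ : localSubgroup κ.kerSubgroup E,
          ((φ.1 τ : AddCommGroup.primaryComponent (localPoints W E) p) : localPoints W E) =
            (τ : absoluteGaloisGroup E) • a - a) →
        oneCocycleClass _ φ = κf x k)
    (x : localTowerPointsOfEmb κ (closureEmb (K := K) E) W) (k : ℕ) (hx : κf x k = 0)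
    (z : localTowerPointsOfEmb κ (closureEmb (K := K) E) W →+ ℤ_[p]) : (p : ℤ_[p]) ^ k ∣ z x := by
  obtain ⟨a, ha⟩ := W.nsmul_surjective_localPoints E (pow_ne_zero k hp.out.ne_zero) (x : localPoints W E)
  change p ^ k • a = (x : localPoints W E) at ha
  obtain ⟨φ, hφ⟩ := exists_kummerCocycle κ E W a (k := k) (by rw [ha]; exact x.2)
  have h0 : oneCocycleClass _ φ = 0 := by rw [hκ x k a ha φ hφ, hx]
  obtain ⟨t, ht⟩ := (oneCocycleClass_eq_zero_iff _ _).mp h0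
  -- `a − t` is fixed by `G`
  have hat : a - (t : localPoints W E) ∈ localTowerPointsOfEmb κ (closureEmb (K := K) E) W := by
    refine (mem_localTowerPointsOfEmb_iff κ (closureEmb (K := K) E) W _).mpr fun τ hτ ↦ ?_
    have h := congrArg (fun m : AddCommGroup.primaryComponent (localPoints W E) p ↦ (m : localPoints W E)) (ht ⟨τ, hτ⟩)
    simp only [hφ] at h
    change τ • a - a = (((⟨τ, hτ⟩ : localSubgroup κ.kerSubgroup E) • t - t :
      AddCommGroup.primaryComponent (localPoints W E) p) : localPoints W E) at h
    rw [AddSubgroupClass.coe_sub, Subgroup.smul_def, Literature.NumberTheory.EllipticCurves.primaryComponent.coe_smul]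
      at h
    rw [smul_sub]
    have : τ • a - a - (τ • (t : localPoints W E) - t) = 0 := by rw [h]; exact sub_self _
    rw [← sub_eq_zero]
    rw [← this]
    abel
  -- the torsion part `p^k t ∈ E(K_∞·E)`
  obtain ⟨m, hm⟩ := t.2
  have hpt : p ^ k • (t : localPoints W E) ∈ localTowerPointsOfEmb κ (closureEmb (K := K) E) W := by
    have h : p ^ k • (t : localPoints W E) = (x : localPoints W E) - p ^ k • (a - (t : localPoints W E)) := by
      rw [smul_sub, ha]; abel
    rw [h]
    exact sub_mem x.2 (AddSubgroup.nsmul_mem _ hat _)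
  have hdecomp : x = p ^ k • (⟨a - (t : localPoints W E), hat⟩ : localTowerPointsOfEmb κ (closureEmb (K := K) E) W) +
      ⟨p ^ k • (t : localPoints W E), hpt⟩ := by
    apply Subtype.ext
    rw [AddSubgroup.coe_add, AddSubgroupClass.coe_nsmul]
    change (x : localPoints W E) = p ^ k • (a - (t : localPoints W E)) + p ^ k • (t : localPoints W E)
    rw [smul_sub, ha]
    abel
  have htors : p ^ m • (⟨p ^ k • (t : localPoints W E), hpt⟩ : localTowerPointsOfEmb κ (closureEmb (K := K) E) W) = 0 := by
    apply Subtype.ext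
    rw [AddSubgroupClass.coe_nsmul, ZeroMemClass.coe_zero, smul_comm, hm, smul_zero]
  rw [hdecomp, map_add, OddBlindNF.apply_eq_zero_of_nsmul_eq_zero z htors, add_zero, map_nsmul, nsmul_eq_mul, Nat.cast_pow]
  exact dvd_mul_right _ _

/-- **Conjugation**: `conj_σ (κf x k) = κf (σ x) k` for every `σ ∈ Γ_E` — on cocycles
`(conj_σ φ)(h) = σ φ(σ⁻¹ h σ) = σ(σ⁻¹hσ a − a) = h(σa) − σa`, the Kummer cocycle of `σ a`, and `p^k (σa) = σ x`.
[cite: NeukirchSchmidtWingberg2008, I §5 (conjugation on cochains)] [cite: GreenbergLNM1716, §1 (the Γ-action on H¹(F_∞, E[p^∞]))] -/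
theorem localKummerMap_conj [W.IsElliptic]
    (hκ : ∀ (x : localTowerPointsOfEmb κ (closureEmb (K := K) E) W) (k : ℕ) (a : localPoints W E),
      p ^ k • a = (x : localPoints W E) →
      ∀ φ : contOneCocycles (discreteTopRep (localSubgroup κ.kerSubgroup E)
          (AddCommGroup.primaryComponent (localPoints W E) p)),
        (∀ τ : localSubgroup κ.kerSubgroup E,
          ((φ.1 τ : AddCommGroup.primaryComponent (localPoints W E) p) : localPoints W E) =
            (τ : absoluteGaloisGroup E) • a - a) →
        oneCocycleClass _ φ = κf x k)
    (σ : absoluteGaloisGroup E)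
    (x : localTowerPointsOfEmb κ (closureEmb (K := K) E) W) (k : ℕ) :
    conjH1 (localSubgroup κ.kerSubgroup E) (AddCommGroup.primaryComponent (localPoints W E) p) σ (κf x k) =
      κf ⟨σ • (x : localPoints W E), smul_mem_localTowerPointsOfEmb κ (closureEmb (K := K) E) W σ x.2⟩ k := by
  obtain ⟨a, ha⟩ := W.nsmul_surjective_localPoints E (pow_ne_zero k hp.out.ne_zero) (x : localPoints W E)
  change p ^ k • a = (x : localPoints W E) at ha
  obtain ⟨φ, hφ⟩ := exists_kummerCocycle κ E W a (k := k) (by rw [ha]; exact x.2)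
  rw [← hκ x k a ha φ hφ]
  -- `conj_σ` on cocycles
  have hc : ∀ (y : localSubgroup κ.kerSubgroup E) (m : AddCommGroup.primaryComponent (localPoints W E) p),
      DistribSMul.toAddMonoidHom _ σ (subgroupConj (localSubgroup κ.kerSubgroup E) σ y • m) =
        y • DistribSMul.toAddMonoidHom _ σ m := fun y m ↦ by
    simp only [DistribSMul.toAddMonoidHom_apply, Subgroup.smul_def, subgroupConj_apply_coe, smul_smul, mul_assoc,
      mul_inv_cancel_left]
  have key := map_oneCocycleClass (discreteTopRep (localSubgroup κ.kerSubgroup E)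
    (AddCommGroup.primaryComponent (localPoints W E) p)) (subgroupConj (localSubgroup κ.kerSubgroup E) σ)
    (resHomOfEquivariant (subgroupConj (localSubgroup κ.kerSubgroup E) σ) (DistribSMul.toAddMonoidHom _ σ) hc) φ
  refine (show conjH1 (localSubgroup κ.kerSubgroup E) (AddCommGroup.primaryComponent (localPoints W E) p) σ
      (oneCocycleClass _ φ) = _ from key).trans ?_
  refine hκ _ k (σ • a) (by rw [smul_comm, ha]) _ fun τ ↦ ?_
  rw [contOneCocycles.pullback_apply]
  change ((σ • φ.1 (subgroupConj (localSubgroup κ.kerSubgroup E) σ τ) :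
    AddCommGroup.primaryComponent (localPoints W E) p) : localPoints W E) = _
  rw [Literature.NumberTheory.EllipticCurves.primaryComponent.coe_smul, hφ, subgroupConj_apply_coe, smul_sub,
    smul_smul, smul_smul, ← mul_assoc, ← mul_assoc, mul_inv_cancel, one_mul, mul_smul]

end Structure

end LocalIwH1

end Summit.BirchSwinnertonDyer.BirchSwinnertonDyer.Theorems

end
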